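import Summits.QuantumFields.QCD.Theses.PauliWegnerSea

/-!
# Crux `FMClosureUnquenched` (stmt-QuantumFields-11512) — proof-side definitions of lines
`thick-collar-far-stability` / `von-mises-circles`

Route-posited objects and packaged stub predicates of the two registered skeletons of the crux
(`Cruxes/FMClosureUnquenched/Lines/thick_collar_far_stability.lean`, `…/von_mises_circles.lean`), copied
VERBATIM (definition bodies byte-identical; docstrings shortened) so that the registered stub theorems
(`stub_twoStar : FibreBandLaw → LocalCofactorDomination → ∀ Nf, TwoStarBounds Nf`, `stub_cofactorDomination`,
`stub_deterministic : LocalCofactorDomination ∧ SideWitness`, `stub_farStability`, `stub_closure`, `stub_corners`) and the final skeleton can land under `Theorems/` by name and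
signature (`Cruxes/…` is not importable from `Theorems/`).  Nothing of the route is restated: `Input`/`Conclusion`
are abbreviations, `crux_iff : FMClosureUnquenched ↔ (K1 → K3 → ∀ Nf reg m > 0, Input → Conclusion)` is `Iff.rfl`.
The registered sanity lemma `farStability_nf_zero` (vacuous `N_f = 0` slice) anchors the file to the stub registry.
§0 crux quantities · §1 side-matrix vocabulary · §2 packaged stub predicates · §3 circle / fibre vocabulary
(def bodies = registered skeleton sha f806a954…, seat prover-line-stmt-QuantumFields-11512-1, 2026-08-16T10:39Z).
Source for §1–§2: Aizenman–Schenker–Friedrich–Hundertmark, CMP 224 (2001) 219 [AizenmanEtAl2001].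
-/

noncomputable section
namespace Summit.QuantumFields.QCD.Theorems.VonMisesCircles
open scoped BigOperators
open MeasureTheory Filter
open Literature.MathematicalPhysics.QuantumFieldTheory Literature.MathematicalPhysics.QuantumLattice
  Literature.Probability.LatticeModels
local notation "𝔾" => Matrix.specialUnitaryGroup (Fin 3) ℂ
/-! ## §0 The crux's own quantities -/
/-- Bare Wilson masses of the regularisation at step `k`: `m_f(k) = m_crit(k) + a_k m_f / Z_m(k)` (verbatim the
lambda of the crux). -/
def bareMass {Nf : ℕ} (reg : QCDRegularisation Nf) (m : Fin Nf → ℝ) (k : ℕ) : Fin Nf → ℝ :=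
  fun fl => reg.mcrit k + reg.a k * m fl / reg.Zm k

/-- The crux's phase-quenched two-point fractional moment on the torus of side `2S+1` at coupling `β`, masses
`mq`, written EXACTLY as in `FMClosureUnquenched`. -/
def cruxMoment (Nf : ℕ) (β : ℝ) (mq : Fin Nf → ℝ) (S : ℕ) (f : Fin Nf)
    (v : Literature.Probability.LatticeModels.Site 4) (s : ℝ) : ℝ :=
  (∫ U : GaugeConfig 4 (2 * S + 1) (Matrix.specialUnitaryGroup (Fin 3) ℂ),
      ‖(diracMatrix U mq).det‖ *
        (∑ a : Fin 3, ∑ i : Fin 4, ∑ b : Fin 3, ∑ j : Fin 4,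
          ‖(diracMatrix U mq)⁻¹ (quarkEquiv (f, (Torus.proj (2 * S + 1) 0, a, i)))
            (quarkEquiv (f, (Torus.proj (2 * S + 1) (v), b, j)))‖) ^ s
      ∂(wilsonMeasure (fundamentalRep (Fin 3)) β)) /
    (∫ U : GaugeConfig 4 (2 * S + 1) (Matrix.specialUnitaryGroup (Fin 3) ℂ),
      ‖(diracMatrix U mq).det‖ ∂(wilsonMeasure (fundamentalRep (Fin 3)) β))

/-- The crux's antecedent (the one-scale input), verbatim up to the abbreviations above. -/
def Input (Nf : ℕ) (reg : QCDRegularisation Nf) (m : Fin Nf → ℝ) : Prop :=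
  ∀ q : ℕ, ∃ K₀ s : ℝ, 0 < s ∧ s < 1 ∧ ∀ᶠ k in atTop, ∃ ℓ₀ : ℕ, 1 ≤ ℓ₀ ∧ ℓ₀ ≤ reg.L k ∧
    (ℓ₀ : ℝ) * reg.a k ≤ K₀ * (1 + |Real.log (reg.a k)|) ∧
    ∀ S : ℕ, reg.L k ≤ S → ∀ (f : Fin Nf) (v : Literature.Probability.LatticeModels.Site 4),
      v ∈ box 4 S → ‖v‖ = (ℓ₀ : ℝ) →
        (ℓ₀ : ℝ) ^ q * (1 + |reg.β k|) ^ q * cruxMoment Nf (reg.β k) (bareMass reg m k) S f v s ≤ 1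

/-- The crux's consequent (clause (ii) of `MobilityGap`), verbatim up to the abbreviations above. -/
def Conclusion (Nf : ℕ) (reg : QCDRegularisation Nf) (m : Fin Nf → ℝ) : Prop :=
  ∃ s δ C : ℝ, 0 < s ∧ s < 1 ∧ 0 < δ ∧ ∀ᶠ k in atTop, ∀ S : ℕ, reg.L k ≤ S →
    ∀ (f : Fin Nf) (v : Literature.Probability.LatticeModels.Site 4), v ∈ box 4 S →
      cruxMoment Nf (reg.β k) (bareMass reg m k) S f v s ≤ C * Real.exp (-(δ * (reg.a k * ‖v‖)))

/-- The crux is literally `K1 → K3 → ∀ Nf reg m > 0, Input → Conclusion` (definitional unfolding; cf. the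
standing disprover's `fmClosure_iff`). -/
theorem crux_iff :
    Summit.QuantumFields.QCD.Theses.PauliWegnerSea.FMClosureUnquenched ↔
      (Summit.QuantumFields.QCD.Theses.PauliWegnerSea.FibreCofactorDomination →
        Summit.QuantumFields.QCD.Theses.PauliWegnerSea.TiltedFlatness →
          ∀ (Nf : ℕ) (reg : QCDRegularisation Nf) (m : Fin Nf → ℝ), (∀ f, 0 < m f) →
            Input Nf reg m → Conclusion Nf reg m) :=
  Iff.rfl
/-! ## §1 Side-matrix vocabulary -/
/-- Quark index of ONE flavour on the torus of side `N`: site × colour × spin. -/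
abbrev QIdx (N : ℕ) : Type := TorusSite 4 N × Fin 3 × Fin 4

/-- `ℓ¹` norm `Σ_{a,i,b,j} |M_{(x,a,i),(y,b,j)}|` of the `(x,y)` colour–spin block of a one-flavour quark matrix. -/
def blockNorm {N : ℕ} (M : Matrix (QIdx N) (QIdx N) ℂ) (x y : TorusSite 4 N) : ℝ :=
  ∑ a : Fin 3, ∑ i : Fin 4, ∑ b : Fin 3, ∑ j : Fin 4, ‖M (x, a, i) (y, b, j)‖

/-- The side matrix `M_A ⊕ 1` of a finite site set `A`: `M` between two sites of `A`, the identity elsewhere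
(ASFH's depletion across `∂A`). -/
def sideMatrix {N : ℕ} [NeZero N] (A : Finset (TorusSite 4 N)) (M : Matrix (QIdx N) (QIdx N) ℂ) :
    Matrix (QIdx N) (QIdx N) ℂ :=
  Matrix.of fun p q => if p.1 ∈ A ∧ q.1 ∈ A then M p q else if p = q then 1 else 0

/-- Side-wise Dirichlet Green function of the site set `A` (ASFH's `G_Ω`): the inverse of `sideMatrix A M`. -/
def gside {N : ℕ} [NeZero N] (A : Finset (TorusSite 4 N)) (M : Matrix (QIdx N) (QIdx N) ℂ) :
    Matrix (QIdx N) (QIdx N) ℂ :=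
  (sideMatrix A M)⁻¹

/-- The odd sup-ball of radius `r` about `x` on the torus of side `2S+1` (faithful for `r ≤ S`); used only through
its complement. -/
def ball (S : ℕ) (x : TorusSite 4 (2 * S + 1)) (r : ℕ) : Finset (TorusSite 4 (2 * S + 1)) :=
  (box 4 r).image fun w => x + Torus.proj (2 * S + 1) w

/-- The sup-sphere of radius `r` about `x` (offsets in `box r` with a coordinate `= ±r`). -/
def sphere (S : ℕ) (x : TorusSite 4 (2 * S + 1)) (r : ℕ) : Finset (TorusSite 4 (2 * S + 1)) :=
  ((box 4 r).filter fun w : Literature.Probability.LatticeModels.Site 4 =>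
      ∃ i, w i = (r : ℤ) ∨ w i = -(r : ℤ)).image
    fun w => x + Torus.proj (2 * S + 1) w

/-- The EVEN box of radius `r` about `x` (offsets in `{-r-1,…,r}⁴`, bipartite-balanced); `W = ebox(x,ℓ)`, `Λ =
ebox(x,3ℓ+2)` are the thick collar's depletion sets. -/
def ebox (S : ℕ) (x : TorusSite 4 (2 * S + 1)) (r : ℕ) : Finset (TorusSite 4 (2 * S + 1)) :=
  (Fintype.piFinset fun _ : Fin 4 => Finset.Icc (-(r : ℤ) - 1) r).image
    fun w => x + Torus.proj (2 * S + 1) w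

/-- Inner boundary of the even box of radius `r` about `x` (a coordinate in `{-r-1, r}`). -/
def boxIn (S : ℕ) (x : TorusSite 4 (2 * S + 1)) (r : ℕ) : Finset (TorusSite 4 (2 * S + 1)) :=
  ((Fintype.piFinset fun _ : Fin 4 => Finset.Icc (-(r : ℤ) - 1) r).filter
      fun w : Literature.Probability.LatticeModels.Site 4 =>
        ∃ i, w i = -(r : ℤ) - 1 ∨ w i = (r : ℤ)).image
    fun w => x + Torus.proj (2 * S + 1) w

/-- Outer boundary of the even box of radius `r` about `x` (a coordinate in `{-r-2, r+1}`). -/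
def boxOut (S : ℕ) (x : TorusSite 4 (2 * S + 1)) (r : ℕ) : Finset (TorusSite 4 (2 * S + 1)) :=
  ((Fintype.piFinset fun _ : Fin 4 => Finset.Icc (-(r : ℤ) - 2) (r + 1)).filter
      fun w : Literature.Probability.LatticeModels.Site 4 =>
        ∃ i, w i = -(r : ℤ) - 2 ∨ w i = (r : ℤ) + 1).image
    fun w => x + Torus.proj (2 * S + 1) w

/-- The one-flavour Wilson–Dirac matrix (`r = 1`, fundamental `SU(3)`) at bare mass `m₀`. -/
def wilsonD {N : ℕ} [NeZero N] (U : GaugeConfig 4 N 𝔾) (m₀ : ℝ) : Matrix (QIdx N) (QIdx N) ℂ :=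
  wilsonDirac (fundamentalRep (Fin 3)) U m₀ 1

/-- Phase-quenched expectation `∫ ‖det D‖ F dμ_W(β) / ∫ ‖det D‖ dμ_W(β)` on the torus of side `2S+1` with the
multi-flavour weight of the crux (same junk conventions; = the tree's `qcdPhaseQuenchedExpect`). -/
def pqE (Nf S : ℕ) (β : ℝ) (mq : Fin Nf → ℝ)
    (F : GaugeConfig 4 (2 * S + 1) 𝔾 → ℝ) : ℝ :=
  (∫ U : GaugeConfig 4 (2 * S + 1) (Matrix.specialUnitaryGroup (Fin 3) ℂ),
      ‖(diracMatrix U mq).det‖ * F U ∂(wilsonMeasure (fundamentalRep (Fin 3)) β)) /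
    (∫ U : GaugeConfig 4 (2 * S + 1) (Matrix.specialUnitaryGroup (Fin 3) ℂ),
      ‖(diracMatrix U mq).det‖ ∂(wilsonMeasure (fundamentalRep (Fin 3)) β))

/-- Admissible sides: the whole torus, an even box, the complement of an even box or of an odd ball (`1 ≤ r`, `r+1 ≤
S`). -/
def AdmissibleSide (S : ℕ) (A : Finset (TorusSite 4 (2 * S + 1))) : Prop :=
  A = Finset.univ ∨
    ∃ (x : TorusSite 4 (2 * S + 1)) (r : ℕ), 1 ≤ r ∧ r + 1 ≤ S ∧
      (A = ebox S x r ∨ A = (ebox S x r)ᶜ ∨ A = (ball S x r)ᶜ)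

/-! ## §2 Packaged stub predicates -/
/-- **Two-star bounds** (T0)/(Tinv)/(T5)/(Tdec)/(T1) in AVERAGED form (ASFH Lemmas 4–6, (2.17)), one constant
`C(1+|β|)^p(1+radius)^p` uniform in volume, outside field, probe mass `∈ [-9,1]` and sea masses; (Tinv) = a.e.
invertibility of the admissible side matrices (reshape gen 1); byte-identical with the registered skeleton f806a954. -/
def TwoStarBounds (Nf : ℕ) : Prop :=
  ∃ s₀ C p : ℝ, 0 < s₀ ∧ s₀ < 1 ∧ 0 < C ∧ ∀ s : ℝ, 0 < s → s ≤ s₀ →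
  ∀ (β : ℝ) (mq : Fin Nf → ℝ) (f : Fin Nf), -9 ≤ mq f → mq f ≤ 1 → ∀ (S : ℕ),
    -- (T0) no junk: positive mass of the weight, integrability of the functionals used
    (0 < ∫ U : GaugeConfig 4 (2 * S + 1) (Matrix.specialUnitaryGroup (Fin 3) ℂ),
        ‖(diracMatrix U mq).det‖ ∂(wilsonMeasure (fundamentalRep (Fin 3)) β)) ∧
    (∀ (s₁ s₂ s₃ : ℝ), 0 ≤ s₁ → s₁ ≤ s₀ → 0 ≤ s₂ → s₂ ≤ s₀ → 0 ≤ s₃ → s₃ ≤ s₀ →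
      ∀ (A₁ A₂ A₃ : Finset (TorusSite 4 (2 * S + 1))),
        AdmissibleSide S A₁ → AdmissibleSide S A₂ → AdmissibleSide S A₃ →
      ∀ (a₁ b₁ a₂ b₂ a₃ b₃ : TorusSite 4 (2 * S + 1)),
      Integrable (fun U : GaugeConfig 4 (2 * S + 1) (Matrix.specialUnitaryGroup (Fin 3) ℂ) =>
        ‖(diracMatrix U mq).det‖ *
          (blockNorm (gside A₁ (wilsonD U (mq f))) a₁ b₁ ^ s₁ *
            blockNorm (gside A₂ (wilsonD U (mq f))) a₂ b₂ ^ s₂ *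
            blockNorm (gside A₃ (wilsonD U (mq f))) a₃ b₃ ^ s₃))
        (wilsonMeasure (fundamentalRep (Fin 3)) β)) ∧
    -- (Tinv) no junk, continued (RESHAPE gen 1): every admissible side matrix of the probe flavour —
    -- and `D` itself (`A = univ`) — is invertible for `μ_W(β)`-a.e. field (the resolvent identities
    -- (Rfwd)/(R2) of `CollarResolventBounds` are stated under these invertibility hypotheses)
    (∀ (A : Finset (TorusSite 4 (2 * S + 1))), AdmissibleSide S A →
      ∀ᵐ U ∂(wilsonMeasure (fundamentalRep (Fin 3)) β), (sideMatrix A (wilsonD U (mq f))).det ≠ 0) ∧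
    -- (T5) a-priori fractional-moment bound, uniform in the volume
    (∀ x y : TorusSite 4 (2 * S + 1),
      pqE Nf S β mq (fun U => blockNorm (wilsonD U (mq f))⁻¹ x y ^ s) ≤ C * (1 + |β|) ^ p) ∧
    -- (Tdec) a depleted factor on an admissible side is replaced by Ξ_r against a full factor
    (∀ (x : TorusSite 4 (2 * S + 1)) (r : ℕ), 1 ≤ r → r + 1 ≤ S →
      ∀ (A : Finset (TorusSite 4 (2 * S + 1))),
        (A = ebox S x r ∨ A = (ebox S x r)ᶜ ∨ A = (ball S x r)ᶜ) →
      ∀ a b c d : TorusSite 4 (2 * S + 1), a ∈ A → b ∈ A →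
        pqE Nf S β mq (fun U =>
            blockNorm (gside A (wilsonD U (mq f))) a b ^ s * blockNorm (wilsonD U (mq f))⁻¹ c d ^ s) ≤
          C * (1 + |β|) ^ p * (1 + (r : ℝ)) ^ p *
            pqE Nf S β mq (fun U => blockNorm (wilsonD U (mq f))⁻¹ c d ^ s)) ∧
    -- (T1) spanning-factor removal between the two cuts of the thick collar
    (∀ (x : TorusSite 4 (2 * S + 1)) (ℓ : ℕ), 1 ≤ ℓ → 3 * ℓ + 4 ≤ S →
      ∀ u u' v v' y : TorusSite 4 (2 * S + 1),
        u' ∈ ebox S x (3 * ℓ + 2) → u' ∉ ebox S x ℓ → v ∈ ebox S x (3 * ℓ + 2) → v ∉ ebox S x ℓ →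
        v' ∉ ebox S x (3 * ℓ + 2) → y ∉ ebox S x (3 * ℓ + 2) →
          pqE Nf S β mq (fun U =>
              blockNorm (gside (ebox S x ℓ) (wilsonD U (mq f))) x u ^ s *
                blockNorm (wilsonD U (mq f))⁻¹ u' v ^ s *
                blockNorm (gside (ebox S x (3 * ℓ + 2))ᶜ (wilsonD U (mq f))) v' y ^ s) ≤
            C * (1 + |β|) ^ p * (1 + (ℓ : ℝ)) ^ p *
              pqE Nf S β mq (fun U =>
                blockNorm (gside (ebox S x ℓ) (wilsonD U (mq f))) x u ^ s *
                  blockNorm (gside (ebox S x (3 * ℓ + 2))ᶜ (wilsonD U (mq f))) v' y ^ s))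

/-- **Far stability of the exit moment across a thick collar** (the load-bearing physical stub): `E[A Ψ] ≤ R·((E
A)^θ + E A)·E Ψ` for the inside factor `A = ‖G_W(x,u)‖^s` and the far factor `Ψ = ‖G_{Λᶜ}(v',y)‖^s`, `R =
C(1+|β|)^p(1+ℓ)^p`, uniformly in `S`, `y`. -/
def FarStability (Nf : ℕ) : Prop :=
  ∃ s₀ C p θ : ℝ, 0 < s₀ ∧ s₀ < 1 ∧ 0 < C ∧ 0 < θ ∧ θ ≤ 1 ∧ ∀ s : ℝ, 0 < s → s ≤ s₀ →
  ∀ (β : ℝ) (mq : Fin Nf → ℝ) (f : Fin Nf), -9 ≤ mq f → mq f ≤ 1 →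
  ∀ (S : ℕ) (x : TorusSite 4 (2 * S + 1)) (ℓ : ℕ), 1 ≤ ℓ → 3 * ℓ + 4 ≤ S →
  ∀ u v' y : TorusSite 4 (2 * S + 1),
    u ∈ ebox S x ℓ → v' ∉ ebox S x (3 * ℓ + 2) → y ∉ ebox S x (3 * ℓ + 2) →
    pqE Nf S β mq (fun U =>
        blockNorm (gside (ebox S x ℓ) (wilsonD U (mq f))) x u ^ s *
          blockNorm (gside (ebox S x (3 * ℓ + 2))ᶜ (wilsonD U (mq f))) v' y ^ s) ≤
      C * (1 + |β|) ^ p * (1 + (ℓ : ℝ)) ^ p *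
        (pqE Nf S β mq (fun U => blockNorm (gside (ebox S x ℓ) (wilsonD U (mq f))) x u ^ s) ^ θ +
          pqE Nf S β mq (fun U => blockNorm (gside (ebox S x ℓ) (wilsonD U (mq f))) x u ^ s)) *
        pqE Nf S β mq (fun U =>
          blockNorm (gside (ebox S x (3 * ℓ + 2))ᶜ (wilsonD U (mq f))) v' y ^ s)

/-- **Collar resolvent bounds** (Rfwd)/(Rin)/(Rout)/(R2) (ASFH (2.11)–(2.16), `ℓ¹` block norms), in the UNFOLDED
vocabulary in which it is registered and LANDED (`…FMClosureUnquenchedResolvent.lean`, `cT = 4`); the `let`s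
are `wilsonD U m₀`, `blockNorm`, `sideMatrix · (wilsonD U m₀)`, `ball S x`, `sphere S x`, `ebox S x`, `boxIn S
x`, `boxOut S x`, definitionally. -/
def CollarResolventBounds : Prop :=
  ∃ cT : ℝ, 0 < cT ∧ ∀ (S : ℕ) (U : GaugeConfig 4 (2 * S + 1) (Matrix.specialUnitaryGroup (Fin 3) ℂ))
      (m₀ : ℝ) (x : TorusSite 4 (2 * S + 1)),
      let D : Matrix (TorusSite 4 (2 * S + 1) × Fin 3 × Fin 4) (TorusSite 4 (2 * S + 1) × Fin 3 × Fin 4) ℂ :=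
        wilsonDirac (fundamentalRep (Fin 3)) U m₀ 1
      let bn : Matrix (TorusSite 4 (2 * S + 1) × Fin 3 × Fin 4) (TorusSite 4 (2 * S + 1) × Fin 3 × Fin 4) ℂ →
          TorusSite 4 (2 * S + 1) → TorusSite 4 (2 * S + 1) → ℝ :=
        fun M y z => ∑ a : Fin 3, ∑ i : Fin 4, ∑ b : Fin 3, ∑ j : Fin 4, ‖M (y, a, i) (z, b, j)‖
      let side : Finset (TorusSite 4 (2 * S + 1)) →
          Matrix (TorusSite 4 (2 * S + 1) × Fin 3 × Fin 4) (TorusSite 4 (2 * S + 1) × Fin 3 × Fin 4) ℂ :=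
        fun A => Matrix.of fun p q => if p.1 ∈ A ∧ q.1 ∈ A then D p q else if p = q then 1 else 0
      let ball : ℕ → Finset (TorusSite 4 (2 * S + 1)) := fun r =>
        (box 4 r).image fun w => x + Torus.proj (2 * S + 1) w
      let sphere : ℕ → Finset (TorusSite 4 (2 * S + 1)) := fun r =>
        ((box 4 r).filter fun w : Literature.Probability.LatticeModels.Site 4 =>
            ∃ i, w i = (r : ℤ) ∨ w i = -(r : ℤ)).image
          fun w => x + Torus.proj (2 * S + 1) w
      let ebox : ℕ → Finset (TorusSite 4 (2 * S + 1)) := fun r =>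
        (Fintype.piFinset fun _ : Fin 4 => Finset.Icc (-(r : ℤ) - 1) r).image
          fun w => x + Torus.proj (2 * S + 1) w
      let boxIn : ℕ → Finset (TorusSite 4 (2 * S + 1)) := fun r =>
        ((Fintype.piFinset fun _ : Fin 4 => Finset.Icc (-(r : ℤ) - 1) r).filter
            fun w : Literature.Probability.LatticeModels.Site 4 =>
              ∃ i, w i = -(r : ℤ) - 1 ∨ w i = (r : ℤ)).image
          fun w => x + Torus.proj (2 * S + 1) w
      let boxOut : ℕ → Finset (TorusSite 4 (2 * S + 1)) := fun r =>
        ((Fintype.piFinset fun _ : Fin 4 => Finset.Icc (-(r : ℤ) - 2) (r + 1)).filter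
            fun w : Literature.Probability.LatticeModels.Site 4 =>
              ∃ i, w i = -(r : ℤ) - 2 ∨ w i = (r : ℤ) + 1).image
          fun w => x + Torus.proj (2 * S + 1) w
      (∀ r : ℕ, 1 ≤ r → r + 1 ≤ S → ∀ z : TorusSite 4 (2 * S + 1), z ∉ ball r →
        (side ((ball r)ᶜ)).det ≠ 0 →
          bn D⁻¹ x z ≤
            cT * ∑ p ∈ sphere r, ∑ p' ∈ sphere (r + 1), bn D⁻¹ x p * bn (side ((ball r)ᶜ))⁻¹ p' z) ∧
      ∀ ℓ : ℕ, 1 ≤ ℓ → ℓ + 2 ≤ S →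
        (∀ u : TorusSite 4 (2 * S + 1), u ∈ ebox ℓ → D.det ≠ 0 →
          bn (side (ebox ℓ))⁻¹ x u ≤
            bn D⁻¹ x u +
              cT * ∑ w' ∈ boxOut ℓ, ∑ w ∈ boxIn ℓ, bn D⁻¹ x w' * bn (side (ebox ℓ))⁻¹ w u) ∧
        (3 * ℓ + 4 ≤ S →
          (∀ v' y : TorusSite 4 (2 * S + 1), v' ∉ ebox (3 * ℓ + 2) → y ∉ ebox (3 * ℓ + 2) →
            D.det ≠ 0 →
              bn (side ((ebox (3 * ℓ + 2))ᶜ))⁻¹ v' y ≤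
                bn D⁻¹ v' y +
                  cT * ∑ w' ∈ boxOut (3 * ℓ + 2), ∑ w ∈ boxIn (3 * ℓ + 2),
                    bn (side ((ebox (3 * ℓ + 2))ᶜ))⁻¹ v' w' * bn D⁻¹ w y) ∧
          (∀ y : TorusSite 4 (2 * S + 1), y ∉ ebox (3 * ℓ + 2) →
            (side (ebox ℓ)).det ≠ 0 → (side ((ebox (3 * ℓ + 2))ᶜ)).det ≠ 0 →
              bn D⁻¹ x y ≤
                cT ^ 2 * ∑ u ∈ boxIn ℓ, ∑ u' ∈ boxOut ℓ,
                  ∑ v ∈ boxIn (3 * ℓ + 2), ∑ v' ∈ boxOut (3 * ℓ + 2),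
                    bn (side (ebox ℓ))⁻¹ x u * bn D⁻¹ u' v *
                      bn (side ((ebox (3 * ℓ + 2))ᶜ))⁻¹ v' y))

/-- **Unit-shell lower bound** (the A5 corner `ℓ₀ = 1`, `β_k → 0` made vacuous: some unit-shell vector has phase-
quenched moment `> 1` at `|β| ≤ β₀`, probe mass `∈ [-8.1, 0.1]`, large side, every `s`); mooted by the `2 ≤
ℓ₀` restatement (`K2Repaired.lean`). -/
def UnitShellLowerBound (Nf : ℕ) : Prop :=
  ∃ β₀ : ℝ, 0 < β₀ ∧ ∃ S₀ : ℕ, ∀ β : ℝ, |β| ≤ β₀ → ∀ (mq : Fin Nf → ℝ) (f : Fin Nf),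
    -(81 / 10 : ℝ) ≤ mq f → mq f ≤ 1 / 10 → ∀ S : ℕ, S₀ ≤ S → ∀ s : ℝ, 0 < s → s < 1 →
      ∃ v : Literature.Probability.LatticeModels.Site 4, v ∈ box 4 S ∧ ‖v‖ = (1 : ℝ) ∧
        1 < cruxMoment Nf β mq S f v s

/-- **Hopping decay** for `|m_f + 4| ≥ 4.1` (every `β`, every background), in the UNFOLDED vocabulary in which it
is registered and LANDED (`…FMClosureUnquenchedHopping.lean`, `C = 1440`, `μ = log(41/40)`); the quotient is
`cruxMoment Nf β mq S f v s` verbatim. -/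
def HoppingDecay (Nf : ℕ) : Prop :=
  ∃ C μ : ℝ, 0 ≤ C ∧ 0 < μ ∧ ∀ (β : ℝ) (mq : Fin Nf → ℝ) (f : Fin Nf), (41 / 10 : ℝ) ≤ |mq f + 4| →
      ∀ (S : ℕ) (s : ℝ), 0 < s → s < 1 →
        ∀ v : Literature.Probability.LatticeModels.Site 4, v ∈ box 4 S →
          (∫ U : GaugeConfig 4 (2 * S + 1) (Matrix.specialUnitaryGroup (Fin 3) ℂ),
              ‖(diracMatrix U mq).det‖ *
                (∑ a : Fin 3, ∑ i : Fin 4, ∑ b : Fin 3, ∑ j : Fin 4,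
                  ‖(diracMatrix U mq)⁻¹ (quarkEquiv (f, (Torus.proj (2 * S + 1) 0, a, i)))
                    (quarkEquiv (f, (Torus.proj (2 * S + 1) (v), b, j)))‖) ^ s
              ∂(wilsonMeasure (fundamentalRep (Fin 3)) β)) /
            (∫ U : GaugeConfig 4 (2 * S + 1) (Matrix.specialUnitaryGroup (Fin 3) ℂ),
              ‖(diracMatrix U mq).det‖ ∂(wilsonMeasure (fundamentalRep (Fin 3)) β)) ≤
          C * Real.exp (-(μ * s * ‖v‖))

/-- Outward decay package: decay at rate `δ a_k` for `‖v‖∞ ≥ ℓ₀(k,f)`, k-uniform constant, `ℓ₀(k,f) a_k ≤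
K₀(1+|log a_k|)`, `ℓ₀(k,f) ≤ L_k`. -/
def OutwardDecayWith (Nf : ℕ) (reg : QCDRegularisation Nf) (m : Fin Nf → ℝ)
    (s δ C K₀ : ℝ) (ℓ₀ : ℕ → Fin Nf → ℕ) : Prop :=
  0 < s ∧ s < 1 ∧ 0 < δ ∧ 0 ≤ C ∧
  (∀ᶠ k in atTop, ∀ f : Fin Nf, (ℓ₀ k f : ℝ) * reg.a k ≤ K₀ * (1 + |Real.log (reg.a k)|)) ∧
  (∀ᶠ k in atTop, ∀ f : Fin Nf, ℓ₀ k f ≤ reg.L k) ∧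
  ∀ᶠ k in atTop, ∀ S : ℕ, reg.L k ≤ S →
    ∀ (f : Fin Nf) (v : Literature.Probability.LatticeModels.Site 4), v ∈ box 4 S → (ℓ₀ k f : ℝ) ≤ ‖v‖ →
      cruxMoment Nf (reg.β k) (bareMass reg m k) S f v s ≤ C * Real.exp (-(δ * (reg.a k * ‖v‖)))

/-- Inward decay package: the complementary region `‖v‖∞ < ℓ₀(k,f)` at the same exponent `s`. -/
def InwardDecayWith (Nf : ℕ) (reg : QCDRegularisation Nf) (m : Fin Nf → ℝ)
    (s δ' C' : ℝ) (ℓ₀ : ℕ → Fin Nf → ℕ) : Prop :=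
  0 < δ' ∧ 0 ≤ C' ∧
  ∀ᶠ k in atTop, ∀ S : ℕ, reg.L k ≤ S →
    ∀ (f : Fin Nf) (v : Literature.Probability.LatticeModels.Site 4), v ∈ box 4 S → ‖v‖ < (ℓ₀ k f : ℝ) →
      cruxMoment Nf (reg.β k) (bareMass reg m k) S f v s ≤ C' * Real.exp (-(δ' * (reg.a k * ‖v‖)))

/-- **Inward extension** (A6, the inward half): two-star bounds + typed input + outward package ⇒ decay inside the
outward radius; no mechanism known off the RP locus; mooted by the outward-only restatement. -/
def InwardExtension (Nf : ℕ) (reg : QCDRegularisation Nf) (m : Fin Nf → ℝ) : Prop :=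
  TwoStarBounds Nf → Input Nf reg m →
    ∀ (s δ C K₀ : ℝ) (ℓ₀ : ℕ → Fin Nf → ℕ), OutwardDecayWith Nf reg m s δ C K₀ ℓ₀ →
      ∃ δ' C' : ℝ, InwardDecayWith Nf reg m s δ' C' ℓ₀

/-! ## §3 This line's content: circle laws, fibre band laws, uniform cofactor domination -/
/-- Trigonometric polynomial of degree `≤ d`: `f θ = Σ_{k=-d}^{d} c_k e^{ikθ}`. -/
def IsTrigPoly (d : ℕ) (f : ℝ → ℂ) : Prop :=
  ∃ c : ℤ → ℂ, ∀ θ : ℝ,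
    f θ = ∑ k ∈ Finset.Icc (-(d : ℤ)) d, c k * Complex.exp ((k : ℂ) * (θ : ℂ) * Complex.I)

/-- Mean of `g` against a non-negative circle weight `w` over one period `[0, 2π]`. -/
def circleMean (w : ℝ → ℝ) (g : ℝ → ℝ) : ℝ :=
  (∫ θ in (0 : ℝ)..(2 * Real.pi), g θ * w θ) / (∫ θ in (0 : ℝ)..(2 * Real.pi), w θ)

/-- **Circle law** for degrees `(d, dJ, dh)`: under any law `∝ e^{h}|J| dθ` (`h` real trig. poly of degree `≤ dh`,
`|h| ≤ κ`; `J ≢ 0` of degree `≤ dJ`) every trig. poly `Q` of degree `≤ d` is (Flat) and has (Neg)ative moments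
against its sup, constants `C(1+κ)^p` depending on the degrees only. -/
def CircleLaw (d dJ dh : ℕ) : Prop :=
  ∃ s₀ C p : ℝ, 0 < s₀ ∧ 0 < C ∧ ∀ (κ : ℝ) (h : ℝ → ℝ) (J Q : ℝ → ℂ),
    0 ≤ κ → IsTrigPoly dh (fun θ => (h θ : ℂ)) → (∀ θ, |h θ| ≤ κ) →
    IsTrigPoly dJ J → (∃ θ, J θ ≠ 0) → IsTrigPoly d Q →
      let w : ℝ → ℝ := fun θ => Real.exp (h θ) * ‖J θ‖
      (∀ θ₀ : ℝ, ‖Q θ₀‖ ≤ C * (1 + κ) ^ p * circleMean w (fun θ => ‖Q θ‖)) ∧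
      (∀ s : ℝ, 0 < s → s ≤ s₀ →
        IntervalIntegrable (fun θ => ‖Q θ‖ ^ (-s) * w θ) volume 0 (2 * Real.pi) ∧
        circleMean w (fun θ => ‖Q θ‖ ^ (-s)) ≤ C * (1 + κ) ^ p * (⨆ θ : ℝ, ‖Q θ‖) ^ (-s))

/-- **Fibre polynomial of degree `≤ d`**: continuous, and a trig. polynomial of degree `≤ d` along every one-link
conjugate-circle orbit `θ ↦ W[e ↦ W_e · V T(θ) V⁻¹ · B]`, `T = diag(e^{iθ}, e^{-iθ}, 1)`. -/
def IsFibrePoly {N : ℕ} (d : ℕ) (F : GaugeConfig 4 N 𝔾 → ℂ) : Prop :=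
  Continuous F ∧ ∀ (W : GaugeConfig 4 N 𝔾) (e : Edge 4 N) (V B : 𝔾) (T : ℝ → 𝔾),
    (∀ θ : ℝ, ((T θ : 𝔾) : Matrix (Fin 3) (Fin 3) ℂ) =
        Matrix.diagonal ![Complex.exp (θ * Complex.I), Complex.exp (-(θ * Complex.I)), 1]) →
      IsTrigPoly d (fun θ => F (Function.update W e (W e * (V * T θ * V⁻¹) * B)))

/-- **Fibre band law**: on every fibre of `≤ n` links (outside frozen to `U`), under `e^{-βS_W}‖P‖·Haar` for any
fibre polynomials `P ≢ 0`, `Q` of degree `≤ d` and every `β ∈ ℝ`: (AE) `Q ≢ 0 ⇒ Q∘refit ≠ 0` a.e.; (Flat)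
`‖Q(refit W₀)‖ ≤ C(1+|β|)^p·mean`; (Neg) `∫‖Q∘refit‖^{-s}wt/Z ≤ C(1+|β|)^p (sup‖Q∘refit‖)^{-s}` for `0 < s ≤
s₀`; constants depend on `n, d` only. -/
def FibreBandLaw : Prop :=
  ∀ n d : ℕ, ∃ s₀ C p : ℝ, 0 < s₀ ∧ 0 < C ∧ ∀ (N : ℕ) [NeZero N] (R : Finset (Edge 4 N)), R.card ≤ n →
    ∀ (U : GaugeConfig 4 N 𝔾) (β : ℝ) (P Q : GaugeConfig 4 N 𝔾 → ℂ), IsFibrePoly d P → IsFibrePoly d Q →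
      let refit : GaugeConfig 4 N 𝔾 → GaugeConfig 4 N 𝔾 := fun W e => if e ∈ R then W e else U e
      let wt : GaugeConfig 4 N 𝔾 → ℝ := fun W =>
        Real.exp (-(β * wilsonAction (fundamentalRep (Fin 3)) (refit W))) * ‖P (refit W)‖
      let haar : Measure (GaugeConfig 4 N 𝔾) := Measure.pi fun _ => haarProbability 𝔾
      let Z : ℝ := ∫ W, wt W ∂haar
      (∃ W, P (refit W) ≠ 0) →
        ((∃ W, Q (refit W) ≠ 0) → ∀ᵐ W ∂haar, Q (refit W) ≠ 0) ∧
        (∀ W₀ : GaugeConfig 4 N 𝔾,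
          ‖Q (refit W₀)‖ ≤ C * (1 + |β|) ^ p * ((∫ W, ‖Q (refit W)‖ * wt W ∂haar) / Z)) ∧
        (∀ s : ℝ, 0 < s → s ≤ s₀ →
          Integrable (fun W => ‖Q (refit W)‖ ^ (-s) * wt W) haar ∧
          (∫ W, ‖Q (refit W)‖ ^ (-s) * wt W ∂haar) / Z ≤
            C * (1 + |β|) ^ p * (⨆ W : GaugeConfig 4 N 𝔾, ‖Q (refit W)‖) ^ (-s))

/-- **Local (uniform) cofactor domination, K1♭**: one `C₀` with `sup_fibre ‖adj(D_A ⊕ 1)_{xy}‖₁ ≤ C₀ sup_fibre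
|det(D_A ⊕ 1)|` on the two-star fibre of `x, y ∈ A` (diagonal included), every admissible side, background and
probe mass `m₀ ∈ [-9,1]` (K1 without the `(1+n_w)` allowance). -/
def LocalCofactorDomination : Prop :=
  ∃ C₀ : ℝ, 0 < C₀ ∧ ∀ (m₀ : ℝ), -9 ≤ m₀ → m₀ ≤ 1 →
    ∀ (S : ℕ) (U : GaugeConfig 4 (2 * S + 1) 𝔾) (A : Finset (TorusSite 4 (2 * S + 1))),
      AdmissibleSide S A → ∀ (x y : TorusSite 4 (2 * S + 1)), x ∈ A → y ∈ A →
        let star : Edge 4 (2 * S + 1) → Prop := fun e =>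
          e.1 = x ∨ Site.shift e.1 e.2 = x ∨ e.1 = y ∨ Site.shift e.1 e.2 = y
        let refit : GaugeConfig 4 (2 * S + 1) 𝔾 → GaugeConfig 4 (2 * S + 1) 𝔾 :=
          fun W e => if star e then W e else U e
        ∀ W : GaugeConfig 4 (2 * S + 1) 𝔾, ∃ W' : GaugeConfig 4 (2 * S + 1) 𝔾,
          blockNorm ((sideMatrix A (wilsonD (refit W) m₀)).adjugate) x y ≤
            C₀ * ‖(sideMatrix A (wilsonD (refit W') m₀)).det‖

/-- **Side witness** (reshape gen 1 of line `von-mises-circles`): for every probe mass `m₀ ∈ [-9,1]`, every odd torus and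
every admissible side `A`, ONE gauge field at which the side matrix `D_A ⊕ 1` is invertible (with (AE) of `FibreBandLaw`
it gives a.e. invertibility, clause (Tinv) of `TwoStarBounds`). -/
def SideWitness : Prop :=
  ∀ (m₀ : ℝ), -9 ≤ m₀ → m₀ ≤ 1 →
    ∀ (S : ℕ) (A : Finset (TorusSite 4 (2 * S + 1))), AdmissibleSide S A →
      ∃ U : GaugeConfig 4 (2 * S + 1) 𝔾, (sideMatrix A (wilsonD U m₀)).det ≠ 0
/-! ## §4 Registered sanity lemma -/
/-- The vacuous `N_f = 0` slice of `FarStability` (`Fin 0` is empty): registered on the crux as the anchor of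
this definitions file. -/
theorem farStability_nf_zero : FarStability 0 := by
  refine ⟨1 / 2, 1, 1, 1, by norm_num, by norm_num, by norm_num, by norm_num, le_rfl, ?_⟩
  intro s _ _ β mq f
  exact f.elim0
end Summit.QuantumFields.QCD.Theorems.VonMisesCircles
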